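import Mathlib
import Literature.Analysis.FluidPDE.Tao2016AveragedNS.ShiftSetCascadeFlows
import Summits.NavierStokesRegularity.NavierStokesRegularity.Theorems.TaoLadderRungTwoFlatRenormFrameOn
import Summits.NavierStokesRegularity.NavierStokesRegularity.Theorems.TaoLadderRungTwoFlatQuadPolarOn
import Summits.NavierStokesRegularity.NavierStokesRegularity.Theorems.TaoLadderRungTwoFlatLinearisedUniqueness
import Summits.NavierStokesRegularity.NavierStokesRegularity.Theorems.TaoLadderRungTwoFlatForcedGronwall
import HarnessLib

/-!
# Continuity of the cascade dynamics AT scale ratio `1`: the renormalised table is `O(ε₀)`-close to the table,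
  hence exact solutions of the graded lattice (in the renormalised frame) stay `O(ε₀)`-close to homogeneous
  ones over fixed times (helper for item stmt-NavierStokesRegularity-22987 `FlatGapCertificatesV2`, crux K_A♭
  of route TaoLadderRungTwoFlat; cell harvest/h2-tao-ladder, p1 g19)

* `abs_rpow_sub_one_le` — `|(1+x)^e − 1| ≤ 31·x` for `0 ≤ x ≤ 1`, `|e| ≤ 5` (elementary);
* `abs_renormTable_sub_le` — on a shift set whose classes satisfy `|μ₃ − μ₁ − μ₂| ≤ 2` (true for `S` and `S♭`:
  `shiftBalance_shiftSetFlat`), `|α̃_{ε₀}(μ) − α(μ)| ≤ 31·ε₀·|α(μ)|` for `0 ≤ ε₀ ≤ 1`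
  (`α̃ = RenormFrame.renormTable ε₀ α`); `tableAbsSum_renormTable_sub_le` — `‖α̃ − α‖₁ ≤ 31 ε₀ ‖α‖₁`;
* `abs_sub_le_renorm` — **two exact global solutions at scale ratio `1` with the same data, one for the
  renormalised table `α̃_{ε₀}` (= the graded lattice at ratio `1+ε₀` in the variables `U = c·X`,
  `RenormFrame.clockW_mul_quadTermOn`) and one for `α`, both bounded by `M`, satisfy
  `|U − X|(s) ≤ 31 ε₀ ‖α‖₁ M² s · exp(2‖α̃‖₁ M s)`**: the K_A♭ dynamics is Lipschitz in `ε₀` at `ε₀ = 0` over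
  any fixed time, uniformly in the shell index — the zeroth-order input of the transfer lemma.

HONEST FRAMING: elementary real analysis for a MODEL lattice; nothing certified; nothing about the
Navier–Stokes equations.
-/

noncomputable section

-- the sub-problem namespace repeats the summit name by design (D-0017)
set_option linter.dupNamespace false

namespace Summit.NavierStokesRegularity.NavierStokesRegularity.Theorems

open Set Filter Literature.Analysis.FluidPDE Literature.Analysis.FluidPDE.TaoCascade
open scoped Topology

namespace QuadPolar

variable {m : ℕ}

/-- `(1+x)^5 − 1 ≤ 31 x` on `[0, 1]`. [folklore] -/
theorem pow_five_sub_one_le {x : ℝ} (hx0 : 0 ≤ x) (hx1 : x ≤ 1) : (1 + x) ^ (5 : ℕ) - 1 ≤ 31 * x := by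
  nlinarith [mul_nonneg hx0 hx0, mul_nonneg (mul_nonneg hx0 hx0) hx0,
    mul_nonneg (mul_nonneg (mul_nonneg hx0 hx0) hx0) hx0, mul_le_mul_of_nonneg_left hx1 hx0,
    pow_le_one₀ hx0 hx1 (n := 2), pow_le_one₀ hx0 hx1 (n := 3), pow_le_one₀ hx0 hx1 (n := 4)]

/-- **`|(1+x)^e − 1| ≤ 31·x`** for `0 ≤ x ≤ 1` and `|e| ≤ 5` (real exponent). [folklore] -/
theorem abs_rpow_sub_one_le {x e : ℝ} (hx0 : 0 ≤ x) (hx1 : x ≤ 1) (he : |e| ≤ 5) :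
    |(1 + x) ^ e - 1| ≤ 31 * x := by
  have hL : (1 : ℝ) ≤ 1 + x := by linarith
  have hL0 : (0 : ℝ) < 1 + x := by linarith
  have h5 : (1 + x) ^ (5 : ℝ) - 1 ≤ 31 * x := by
    rw [show ((5 : ℝ)) = ((5 : ℕ) : ℝ) by norm_num, Real.rpow_natCast]
    exact pow_five_sub_one_le hx0 hx1
  have he' : -5 ≤ e ∧ e ≤ 5 := abs_le.mp he
  rcases le_or_gt 0 e with hpos | hneg
  · -- `1 ≤ (1+x)^e ≤ (1+x)^5`
    have h1 : (1 : ℝ) ≤ (1 + x) ^ e := Real.one_le_rpow hL hpos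
    have h2 : (1 + x) ^ e ≤ (1 + x) ^ (5 : ℝ) := Real.rpow_le_rpow_of_exponent_le hL he'.2
    rw [abs_of_nonneg (by linarith)]
    linarith
  · -- `(1+x)^{-5} ≤ (1+x)^e ≤ 1`, and `1 − (1+x)^{-5} ≤ (1+x)^5 − 1`
    have h1 : (1 + x) ^ e ≤ 1 := Real.rpow_le_one_of_one_le_of_nonpos hL hneg.le
    have h2 : (1 + x) ^ (-5 : ℝ) ≤ (1 + x) ^ e := Real.rpow_le_rpow_of_exponent_le hL he'.1
    have h3 : 1 - (1 + x) ^ (-5 : ℝ) ≤ (1 + x) ^ (5 : ℝ) - 1 := by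
      have hp : 0 < (1 + x) ^ (5 : ℝ) := Real.rpow_pos_of_pos hL0 _
      have hinv : (1 + x) ^ (-5 : ℝ) = ((1 + x) ^ (5 : ℝ))⁻¹ := by
        rw [show (-5 : ℝ) = -(5 : ℝ) by norm_num, Real.rpow_neg hL0.le]
      rw [hinv]
      have hge : 1 ≤ (1 + x) ^ (5 : ℝ) := Real.one_le_rpow hL (by norm_num)
      -- `1 − 1/p ≤ p − 1` for `p ≥ 1`
      have : ((1 + x) ^ (5 : ℝ))⁻¹ ≥ 2 - (1 + x) ^ (5 : ℝ) := by
        rw [ge_iff_le, ← sub_nonneg]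
        have e1 : ((1 + x) ^ (5 : ℝ))⁻¹ - (2 - (1 + x) ^ (5 : ℝ)) =
            ((1 + x) ^ (5 : ℝ) - 1) ^ 2 / (1 + x) ^ (5 : ℝ) := by
          field_simp
          ring
        rw [e1]
        positivity
      linarith
    rw [abs_of_nonpos (by linarith)]
    linarith

/-- SHELL BALANCE of a shift class: `|μ₃ − μ₁ − μ₂| ≤ 2` (so the renormalisation exponent
`(5/2)(μ₃−μ₁−μ₂)` has modulus `≤ 5`). [cite: Tao2016AveragedNS, §4 after (4.1)] -/
def ShiftBalance (𝕊 : Finset (ℤ × ℤ × ℤ)) : Prop :=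
  ∀ μ ∈ 𝕊, (μ.2.2 - μ.1 - μ.2.1).natAbs ≤ 2

/-- `S♭` is shell balanced. [cite: Tao2016AveragedNS, §4 after (4.1); cell vocabulary] -/
theorem shiftBalance_shiftSetFlat : ShiftBalance shiftSetFlat := by
  unfold ShiftBalance; decide

/-- Tao's `S` is shell balanced. [cite: Tao2016AveragedNS, §4 after (4.1)] -/
theorem shiftBalance_shiftSet : ShiftBalance shiftSet := by
  unfold ShiftBalance; decide

/-- **The renormalised table is `O(ε₀)`-close to the table**: `|α̃_{ε₀}(μ) − α(μ)| ≤ 31 ε₀ |α(μ)|` for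
`0 ≤ ε₀ ≤ 1` on a shell-balanced shift set (entries off `𝕊` are irrelevant but obey the same bound when they
vanish; we state it on `𝕊`). [cite: Tao2016AveragedNS, §4 (4.8); cell harvest/h2-tao-ladder, renormalised frame] -/
theorem abs_renormTable_sub_le {𝕊 : Finset (ℤ × ℤ × ℤ)} (h𝕊 : ShiftBalance 𝕊) {ε₀ : ℝ} (hε0 : 0 ≤ ε₀)
    (hε1 : ε₀ ≤ 1) (α : Fin m → Fin m → Fin m → ℤ × ℤ × ℤ → ℝ) (i₁ i₂ i₃ : Fin m) {μ : ℤ × ℤ × ℤ}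
    (hμ : μ ∈ 𝕊) :
    |RenormFrame.renormTable ε₀ α i₁ i₂ i₃ μ - α i₁ i₂ i₃ μ| ≤ 31 * ε₀ * |α i₁ i₂ i₃ μ| := by
  have he : |(5 : ℝ) * (μ.2.2 - μ.1 - μ.2.1) / 2| ≤ 5 := by
    have hb := h𝕊 μ hμ
    have hk : (|μ.2.2 - μ.1 - μ.2.1| : ℤ) ≤ 2 := by
      rw [Int.abs_eq_natAbs]; exact_mod_cast hb
    have hz : |((μ.2.2 - μ.1 - μ.2.1 : ℤ) : ℝ)| ≤ 2 := by
      rw [← Int.cast_abs]; exact_mod_cast hk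
    rw [abs_div, abs_mul, abs_of_pos (by norm_num : (0 : ℝ) < 5), abs_of_pos (by norm_num : (0 : ℝ) < 2)]
    push_cast at hz
    linarith
  have hr := abs_rpow_sub_one_le hε0 hε1 he
  rw [RenormFrame.renormTable, show α i₁ i₂ i₃ μ * (1 + ε₀) ^ ((5 : ℝ) * (μ.2.2 - μ.1 - μ.2.1) / 2) - α i₁ i₂ i₃ μ =
    α i₁ i₂ i₃ μ * ((1 + ε₀) ^ ((5 : ℝ) * (μ.2.2 - μ.1 - μ.2.1) / 2) - 1) by ring, abs_mul]
  calc |α i₁ i₂ i₃ μ| * |(1 + ε₀) ^ ((5 : ℝ) * (μ.2.2 - μ.1 - μ.2.1) / 2) - 1|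
      ≤ |α i₁ i₂ i₃ μ| * (31 * ε₀) := mul_le_mul_of_nonneg_left hr (abs_nonneg _)
    _ = 31 * ε₀ * |α i₁ i₂ i₃ μ| := by ring

/-- **`‖α̃ − α‖₁ ≤ 31 ε₀ ‖α‖₁`** on a shell-balanced shift set, `0 ≤ ε₀ ≤ 1`.
[cite: Tao2016AveragedNS, §4 (4.8); cell harvest/h2-tao-ladder, renormalised frame] -/
theorem tableAbsSum_renormTable_sub_le {𝕊 : Finset (ℤ × ℤ × ℤ)} (h𝕊 : ShiftBalance 𝕊) {ε₀ : ℝ}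
    (hε0 : 0 ≤ ε₀) (hε1 : ε₀ ≤ 1) (α : Fin m → Fin m → Fin m → ℤ × ℤ × ℤ → ℝ) :
    tableAbsSum 𝕊 (RenormFrame.renormTable ε₀ α - α) ≤ 31 * ε₀ * tableAbsSum 𝕊 α := by
  unfold tableAbsSum
  simp only [Finset.mul_sum, Pi.sub_apply]
  refine Finset.sum_le_sum fun i _ => Finset.sum_le_sum fun i₁ _ => Finset.sum_le_sum fun i₂ _ =>
    Finset.sum_le_sum fun μ hμ => ?_
  exact abs_renormTable_sub_le h𝕊 hε0 hε1 α i₁ i₂ i hμ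

/-- **CONTINUITY OF THE CASCADE DYNAMICS AT `ε₀ = 0`** (renormalised frame, any shell-balanced shift set):
if `U` is an exact global solution of the homogeneous lattice of the RENORMALISED table `α̃_{ε₀}`
(= the graded lattice at ratio `1+ε₀` in the variables `U = c·X`) and `X` one of the table `α`, with the same
data, both bounded by `M`, then `|U_{i,n}(s) − X_{i,n}(s)| ≤ 31 ε₀ ‖α‖₁ M² s · exp(2‖α̃‖₁ M s)` on `[0, T]`
(`0 ≤ ε₀ ≤ 1`). [cite: Tao2016AveragedNS, §4 (4.8), §6.4; cell harvest/h2-tao-ladder, renormalised frame] -/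
theorem abs_sub_le_renorm {𝕊 : Finset (ℤ × ℤ × ℤ)} (h𝕊 : ShiftBalance 𝕊) {ε₀ : ℝ} (hε0 : 0 ≤ ε₀)
    (hε1 : ε₀ ≤ 1) (α : Fin m → Fin m → Fin m → ℤ × ℤ × ℤ → ℝ) {U X : Fin m → ℤ → ℝ → ℝ} {M T : ℝ}
    (hU : ∀ i n t, HasDerivAt (U i n) (quadTermOn 𝕊 0 (RenormFrame.renormTable ε₀ α) U i n t) t)
    (hX : ∀ i n t, HasDerivAt (X i n) (quadTermOn 𝕊 0 α X i n t) t)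
    (hUb : ∀ i n t, |U i n t| ≤ M) (hXb : ∀ i n t, |X i n t| ≤ M) (h0 : ∀ i n, U i n 0 = X i n 0)
    (i : Fin m) (n : ℤ) {s : ℝ} (hs : s ∈ Icc 0 T) :
    |U i n s - X i n s| ≤ 31 * ε₀ * tableAbsSum 𝕊 α * M ^ 2 * s *
      Real.exp (2 * tableAbsSum 𝕊 (RenormFrame.renormTable ε₀ α) * M * s) := by
  have h := abs_sub_le_of_tables 𝕊 (RenormFrame.renormTable ε₀ α) α hU hX hUb hXb h0 i n hs
  have ht := tableAbsSum_renormTable_sub_le h𝕊 hε0 hε1 α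
  have hpos : 0 ≤ M ^ 2 * s * Real.exp (2 * tableAbsSum 𝕊 (RenormFrame.renormTable ε₀ α) * M * s) := by
    have := hs.1; positivity
  calc |U i n s - X i n s|
      ≤ tableAbsSum 𝕊 (RenormFrame.renormTable ε₀ α - α) * M ^ 2 * s *
          Real.exp (2 * tableAbsSum 𝕊 (RenormFrame.renormTable ε₀ α) * M * s) := h
    _ = tableAbsSum 𝕊 (RenormFrame.renormTable ε₀ α - α) *
          (M ^ 2 * s * Real.exp (2 * tableAbsSum 𝕊 (RenormFrame.renormTable ε₀ α) * M * s)) := by ring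
    _ ≤ (31 * ε₀ * tableAbsSum 𝕊 α) *
          (M ^ 2 * s * Real.exp (2 * tableAbsSum 𝕊 (RenormFrame.renormTable ε₀ α) * M * s)) :=
        mul_le_mul_of_nonneg_right ht hpos
    _ = 31 * ε₀ * tableAbsSum 𝕊 α * M ^ 2 * s *
          Real.exp (2 * tableAbsSum 𝕊 (RenormFrame.renormTable ε₀ α) * M * s) := by ring

end QuadPolar

end Summit.NavierStokesRegularity.NavierStokesRegularity.Theorems

end
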